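import Summits.HodgeConjecture.HodgeConjecture.Theorems.F0P3cDyRamFourFramePieces      -- ★ DEFS LEAF №3 (p854653): `wMatrix`, `InLevel`, `NearTransvShell`, the pieces
import Summits.HodgeConjecture.HodgeConjecture.Theorems.F0P3cDyRamPiecesShellLemmas     -- ★ p854733: `inLevel_zero`, `not_nearTransvShell_zero`, `inLevel_of_mul_self_eq_zero`
import HarnessLib

/-!
# Crux `H413`, line LH4 «(D-RAM) FOUR-FRAME», tier 2 under `U4_Rows` §2 (the unipotent TABLE): the `w`-ADIC MATRIX `wMatrix` IS MULTIPLICATIVE, and the two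
# conjugation-invariant vanishing conditions of the table — «`X = 0`» and «`X² = 0`», `X := wMatrix g − 1` — descend from a class representative to the whole class

Cell `hodgecm-mathlib` (D-0151), FLOOR 0, crux item H413 = `stmt-HodgeConjecture-24833`, route of record `HCCMUnconditional`; squad F0∕P3c∕LH4, Track A; dealer LH4-plan
(g10) WORD #16∕#17 (U4 §2 `stub_U4_table_vanishing`: «`unipotentLabel u < j ⇒ O_u(gselStar j) = 0`»), tier-2 hand LH4-p03 (g11).  THEOREMS ONLY (no `def`, no instance,
no notation, no `sorry`, default heartbeats); imports ★ №3 + ★ `F0P3cDyRamPiecesShellLemmas` + HarnessLib; lane `--supports stmt-HodgeConjecture-24833 --as helper`.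

WHAT IS PROVED.  §1 `wMatrix_one`, `wMatrix_mul`, `wMatrix_inv`, `wMatrix_conj_sub_one` (`wMatrix (x g x⁻¹) − 1 = W·(wMatrix g − 1)·W⁻¹`, `W = wMatrix x`, an honest
matrix inverse with `W·W⁻¹ = 1`).  §2 for CONJUGATE elements `g′ = x g x⁻¹`: `wMatrix g − 1 = 0 ⇒ wMatrix g′ − 1 = 0` and `(wMatrix g − 1)² = 0 ⇒ (wMatrix g′ − 1)² = 0`;
class forms over `ConjClasses.mk g′ = ConjClasses.mk g` (★ `isConj_iff`).  §3 the SUPPORT consequences for the explicit pieces of ★ №3: if the class of `g` has `wMatrix g = 1`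
then NO element of the class lies in the support sets of `f_{T+}`, `f_{T−}` (the shell excludes `X = 0`, ★ `not_nearTransvShell_zero`) nor of `f_reg` (`X² = 0 ∈ ϖ^{m*}M₃`);
if `(wMatrix g − 1)² = 0` then no element of the class lies in `f_reg`'s support — whence, by ★ `classOrbitalIntegral_indicator_eq_zero_of_forall_not_mem`, the table
entries `(u, f_{T±})` for `label u = 0` and `(u, f_reg)` for `label u ∈ {0,1,2}` VANISH (next file: the `Fin 4` bookkeeping against ★ №6 `unipotentLabel` and the one
M-sized entry `(T₊-class, f_{T−})` = «on the shell `NormClassPlus ⇒ LabelPlus`»).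

HONEST LABEL.  Count-neutral helper; no stub is paid here.  (D-RAM) verdict of record PRINT [LanglandsShelstad1989 Thm. p. 484 ∕ Rogawski1990 Prop. 4.9.1 (a)] ∕ XL;
`HC_CM` is proved only modulo the 7 printed citations (2 remaining: hLiu418 = `stmt-HodgeConjecture-24832`, h413 = `stmt-HodgeConjecture-24833`) until rung 0 closes.
-/

noncomputable section

namespace Summit.HodgeConjecture.HodgeConjecture.Cruxes.H413.F0P3cDyRamWMatrixConj

open MeasureTheory Measure NumberField IsDedekindDomain Topology Filter
open Literature.NumberTheory.Automorphic Literature.NumberTheory.Automorphic.UnitaryGroup Literature.NumberTheory.Automorphic.IntegralReduction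
open Literature.NumberTheory.Rogawski1990 Literature.NumberTheory.GaloisRepresentations
open Summit.HodgeConjecture.HodgeConjecture.Cruxes.H413.F0P3cDyRamFourFramePieces
open Summit.HodgeConjecture.HodgeConjecture.Cruxes.H413.F0P3cDyRamPiecesShellLemmas
open scoped Matrix MatrixGroups Classical ValuativeRel

variable (L : Type) [Field L] [NumberField L] [IsCMField L] {v : HeightOneSpectrum (𝓞 ↥(maximalRealSubfield L))}
  (w : UnitaryGroup.PlacesOver L v) (hw : IsCMField.complexConj L • w.1 = w.1)

/-! ## §1  `wMatrix` is multiplicative -/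

/-- `wMatrix 1 = 1`. -/
theorem wMatrix_one : wMatrix L w hw 1 = 1 := by
  have h1 := map_one (localNonsplitEquiv (IsCMField.complexConj L) (Matrix.of fun i j : Fin 3 => if i.val + j.val + 1 = 3 then (1 : L) else 0) (IsCMField.complexConj_ne_one L) w hw)
  have h4 := congrArg (fun z : ↥(unitaryGroupOfForm (galAdicCompletionMap (L := L) (IsCMField.complexConj L) hw) (placeForm (Matrix.of fun i j : Fin 3 => if i.val + j.val + 1 = 3 then (1 : L) else 0) w.1)) => ((z : GL (Fin 3) (w.1.adicCompletion L)) : Matrix (Fin 3) (Fin 3) (w.1.adicCompletion L))) h1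
  simp only [OneMemClass.coe_one, Units.val_one] at h4
  exact h4

/-- `wMatrix (a·b) = wMatrix a · wMatrix b`. -/
theorem wMatrix_mul (a b : ((UnitaryGroup.cmDatum L 3 (Matrix.of fun i j : Fin 3 => if i.val + j.val + 1 = 3 then (1 : L) else 0)).Local v)) :
    wMatrix L w hw (a * b) = wMatrix L w hw a * wMatrix L w hw b := by
  have h1 := map_mul (localNonsplitEquiv (IsCMField.complexConj L) (Matrix.of fun i j : Fin 3 => if i.val + j.val + 1 = 3 then (1 : L) else 0) (IsCMField.complexConj_ne_one L) w hw) a b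
  have h4 := congrArg (fun z : ↥(unitaryGroupOfForm (galAdicCompletionMap (L := L) (IsCMField.complexConj L) hw) (placeForm (Matrix.of fun i j : Fin 3 => if i.val + j.val + 1 = 3 then (1 : L) else 0) w.1)) => ((z : GL (Fin 3) (w.1.adicCompletion L)) : Matrix (Fin 3) (Fin 3) (w.1.adicCompletion L))) h1
  simp only [Subgroup.coe_mul, Units.val_mul] at h4
  exact h4

/-- `wMatrix a⁻¹ = (wMatrix a)⁻¹` (matrix inverse of an invertible matrix). -/
theorem wMatrix_inv (a : ((UnitaryGroup.cmDatum L 3 (Matrix.of fun i j : Fin 3 => if i.val + j.val + 1 = 3 then (1 : L) else 0)).Local v)) :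
    wMatrix L w hw a⁻¹ = (wMatrix L w hw a)⁻¹ := by
  have h1 := map_inv (localNonsplitEquiv (IsCMField.complexConj L) (Matrix.of fun i j : Fin 3 => if i.val + j.val + 1 = 3 then (1 : L) else 0) (IsCMField.complexConj_ne_one L) w hw) a
  have h4 := congrArg (fun z : ↥(unitaryGroupOfForm (galAdicCompletionMap (L := L) (IsCMField.complexConj L) hw) (placeForm (Matrix.of fun i j : Fin 3 => if i.val + j.val + 1 = 3 then (1 : L) else 0) w.1)) => ((z : GL (Fin 3) (w.1.adicCompletion L)) : Matrix (Fin 3) (Fin 3) (w.1.adicCompletion L))) h1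
  simp only [Subgroup.coe_inv, Matrix.coe_units_inv] at h4
  exact h4

/-- `wMatrix a · wMatrix a⁻¹ = 1` and `wMatrix a⁻¹ · wMatrix a = 1`. -/
theorem wMatrix_mul_wMatrix_inv (a : ((UnitaryGroup.cmDatum L 3 (Matrix.of fun i j : Fin 3 => if i.val + j.val + 1 = 3 then (1 : L) else 0)).Local v)) :
    wMatrix L w hw a * wMatrix L w hw a⁻¹ = 1 ∧ wMatrix L w hw a⁻¹ * wMatrix L w hw a = 1 := by
  rw [← wMatrix_mul, ← wMatrix_mul, mul_inv_cancel, inv_mul_cancel, wMatrix_one]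
  exact ⟨rfl, rfl⟩

/-- **Conjugation**: `wMatrix (x·g·x⁻¹) − 1 = wMatrix x · (wMatrix g − 1) · wMatrix x⁻¹`. -/
theorem wMatrix_conj_sub_one (x g : ((UnitaryGroup.cmDatum L 3 (Matrix.of fun i j : Fin 3 => if i.val + j.val + 1 = 3 then (1 : L) else 0)).Local v)) :
    wMatrix L w hw (x * g * x⁻¹) - 1 = wMatrix L w hw x * (wMatrix L w hw g - 1) * wMatrix L w hw x⁻¹ := by
  rw [wMatrix_mul, wMatrix_mul, Matrix.mul_sub, Matrix.sub_mul, Matrix.mul_one, (wMatrix_mul_wMatrix_inv L w hw x).1]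

/-! ## §2  The two conjugation-invariant conditions descend to conjugates -/

/-- `wMatrix g − 1 = 0 ⇒ wMatrix (x·g·x⁻¹) − 1 = 0`. -/
theorem wMatrix_conj_sub_one_eq_zero {x g : ((UnitaryGroup.cmDatum L 3 (Matrix.of fun i j : Fin 3 => if i.val + j.val + 1 = 3 then (1 : L) else 0)).Local v)}
    (h : wMatrix L w hw g - 1 = 0) : wMatrix L w hw (x * g * x⁻¹) - 1 = 0 := by
  rw [wMatrix_conj_sub_one, h, Matrix.mul_zero, Matrix.zero_mul]

/-- `(wMatrix g − 1)² = 0 ⇒ (wMatrix (x·g·x⁻¹) − 1)² = 0` (`(W X W⁻¹)² = W X² W⁻¹`). -/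
theorem wMatrix_conj_sub_one_sq_eq_zero {x g : ((UnitaryGroup.cmDatum L 3 (Matrix.of fun i j : Fin 3 => if i.val + j.val + 1 = 3 then (1 : L) else 0)).Local v)}
    (h : (wMatrix L w hw g - 1) * (wMatrix L w hw g - 1) = 0) :
    (wMatrix L w hw (x * g * x⁻¹) - 1) * (wMatrix L w hw (x * g * x⁻¹) - 1) = 0 := by
  rw [wMatrix_conj_sub_one]
  calc wMatrix L w hw x * (wMatrix L w hw g - 1) * wMatrix L w hw x⁻¹ * (wMatrix L w hw x * (wMatrix L w hw g - 1) * wMatrix L w hw x⁻¹)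
      = wMatrix L w hw x * (wMatrix L w hw g - 1) * (wMatrix L w hw x⁻¹ * wMatrix L w hw x) * (wMatrix L w hw g - 1) * wMatrix L w hw x⁻¹ := by
        simp only [Matrix.mul_assoc]
    _ = 0 := by
        rw [(wMatrix_mul_wMatrix_inv L w hw x).2, Matrix.mul_one, Matrix.mul_assoc (wMatrix L w hw x), h, Matrix.mul_zero, Matrix.zero_mul]

/-- **Class form, `X = 0`**: if `ConjClasses.mk g′ = ConjClasses.mk g` and `wMatrix g − 1 = 0` then `wMatrix g′ − 1 = 0`. -/
theorem wMatrix_sub_one_eq_zero_of_mk_eq {g g' : ((UnitaryGroup.cmDatum L 3 (Matrix.of fun i j : Fin 3 => if i.val + j.val + 1 = 3 then (1 : L) else 0)).Local v)}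
    (hc : ConjClasses.mk g' = ConjClasses.mk g) (h : wMatrix L w hw g - 1 = 0) : wMatrix L w hw g' - 1 = 0 := by
  obtain ⟨x, hx⟩ := isConj_iff.1 (ConjClasses.mk_eq_mk_iff_isConj.1 hc.symm)
  rw [← hx]
  exact wMatrix_conj_sub_one_eq_zero L w hw h

/-- **Class form, `X² = 0`**: if `ConjClasses.mk g′ = ConjClasses.mk g` and `(wMatrix g − 1)² = 0` then `(wMatrix g′ − 1)² = 0`. -/
theorem wMatrix_sub_one_sq_eq_zero_of_mk_eq {g g' : ((UnitaryGroup.cmDatum L 3 (Matrix.of fun i j : Fin 3 => if i.val + j.val + 1 = 3 then (1 : L) else 0)).Local v)}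
    (hc : ConjClasses.mk g' = ConjClasses.mk g) (h : (wMatrix L w hw g - 1) * (wMatrix L w hw g - 1) = 0) :
    (wMatrix L w hw g' - 1) * (wMatrix L w hw g' - 1) = 0 := by
  obtain ⟨x, hx⟩ := isConj_iff.1 (ConjClasses.mk_eq_mk_iff_isConj.1 hc.symm)
  rw [← hx]
  exact wMatrix_conj_sub_one_sq_eq_zero L w hw h

/-! ## §3  Support consequences for the explicit pieces `f_{T+}`, `f_{T−}`, `f_reg` of ★ №3 -/

/-- If `wMatrix g − 1 = 0` then `g` is NOT in the support set of `f_{T+}` (the shell excludes `X = 0`). -/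
theorem not_mem_supportTransvPlus_of_sub_one_eq_zero (ϖ : w.1.adicCompletion L)
    {g : ((UnitaryGroup.cmDatum L 3 (Matrix.of fun i j : Fin 3 => if i.val + j.val + 1 = 3 then (1 : L) else 0)).Local v)} (h : wMatrix L w hw g - 1 = 0) :
    g ∉ {u : ((UnitaryGroup.cmDatum L 3 (Matrix.of fun i j : Fin 3 => if i.val + j.val + 1 = 3 then (1 : L) else 0)).Local v) |
      u ∈ cmLocalIntegralLevel L 3 (Matrix.of fun i j : Fin 3 => if i.val + j.val + 1 = 3 then (1 : L) else 0) v ∧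
      NearTransvShell ϖ (dOfPlace L v w % 2) (mstarFn L v w) (wMatrix L w hw u - 1) ∧
      LabelPlus (galAdicCompletionMap (L := L) (IsCMField.complexConj L) hw) ϖ (dOfPlace L v w) (mstarFn L v w) (wMatrix L w hw u - 1)} := by
  intro hg
  rw [Set.mem_setOf_eq, h] at hg
  exact not_nearTransvShell_zero ϖ _ _ hg.2.1

/-- If `wMatrix g − 1 = 0` then `g` is NOT in the support set of `f_{T−}`. -/
theorem not_mem_supportTransvMinus_of_sub_one_eq_zero (ϖ : w.1.adicCompletion L)
    {g : ((UnitaryGroup.cmDatum L 3 (Matrix.of fun i j : Fin 3 => if i.val + j.val + 1 = 3 then (1 : L) else 0)).Local v)} (h : wMatrix L w hw g - 1 = 0) :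
    g ∉ {u : ((UnitaryGroup.cmDatum L 3 (Matrix.of fun i j : Fin 3 => if i.val + j.val + 1 = 3 then (1 : L) else 0)).Local v) |
      u ∈ cmLocalIntegralLevel L 3 (Matrix.of fun i j : Fin 3 => if i.val + j.val + 1 = 3 then (1 : L) else 0) v ∧
      NearTransvShell ϖ (dOfPlace L v w % 2) (mstarFn L v w) (wMatrix L w hw u - 1) ∧
      ¬ LabelPlus (galAdicCompletionMap (L := L) (IsCMField.complexConj L) hw) ϖ (dOfPlace L v w) (mstarFn L v w) (wMatrix L w hw u - 1)} := by
  intro hg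
  rw [Set.mem_setOf_eq, h] at hg
  exact not_nearTransvShell_zero ϖ _ _ hg.2.1

/-- If `(wMatrix g − 1)² = 0` then `g` is NOT in the support set of `f_reg` (`X² = 0` lies in every level). -/
theorem not_mem_supportReg_of_sub_one_sq_eq_zero (ϖ : w.1.adicCompletion L)
    {g : ((UnitaryGroup.cmDatum L 3 (Matrix.of fun i j : Fin 3 => if i.val + j.val + 1 = 3 then (1 : L) else 0)).Local v)}
    (h : (wMatrix L w hw g - 1) * (wMatrix L w hw g - 1) = 0) :
    g ∉ {u : ((UnitaryGroup.cmDatum L 3 (Matrix.of fun i j : Fin 3 => if i.val + j.val + 1 = 3 then (1 : L) else 0)).Local v) |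
      u ∈ cmLocalIntegralLevel L 3 (Matrix.of fun i j : Fin 3 => if i.val + j.val + 1 = 3 then (1 : L) else 0) v ∧
      ¬ InLevel ϖ (mstarFn L v w) ((wMatrix L w hw u - 1) * (wMatrix L w hw u - 1))} := by
  intro hg
  rw [Set.mem_setOf_eq] at hg
  exact hg.2 (inLevel_of_mul_self_eq_zero ϖ _ h)

end Summit.HodgeConjecture.HodgeConjecture.Cruxes.H413.F0P3cDyRamWMatrixConj

end
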